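import Summits.BirchSwinnertonDyer.Rank1Residual.X12.CMRamifiedRecordSchema
import HarnessLib

/-!
# Leaf `CornerF ∧ p ramified in K` (K12r): certificate-record schema, PART B — the `p`-LEVEL records
# of the slice `p ≥ 5` and the print-family META records of the slice `p = 3` (cell `bsd-print-cfram`,
# typer seat `ty3`; addendum to `X12/CMRamifiedRecordSchema.lean`)

HONEST FRAMING (cell `bsd-print-cfram`, run/shared/lean/pub/bsd-print-cfram/, verbatim in every file
of the cell): PARTITION currency only — the leaf counts when its class theorem is in the kernel BY
NAME, flag-free; Literature named facts are statement-only with cite tags, never sorried theorems;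
every imported theorem carries its printed hypotheses verbatim; numbers, not adjectives. THIS FILE IS
DATA INFRASTRUCTURE (computable records, a decidable recheck); nothing about any elliptic curve is
asserted, no named fact is introduced, nothing is booked, no mark moves (the leaf K12r stays OPEN).

## §1 `LevelRow` — the `p`-levels `n`, `n'` of a cell of the slice `p ≥ 5` (what (★_an) reads)

The O11 residual at `p = |d_K| ≥ 5` is the value law (R-EU) / (★_an)
`ord_π 𝔠 = ν + ord_p #Ш_an(E) + ord_p #Ш_an(E')`, `ν = n + n'`
(`X12/O11/RamifiedStrictDescent.lean`, module docstring; `E' = E^{(d_K)}` the `p`-isogenous twist), where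
`n` (resp. `n'`) is the `p`-DIVISIBILITY LEVEL of a generator of `E(ℚ)` (resp. `E'(ℚ)`) in `E(ℚ_p)`:
with `m = 2·p·#E(ℚ)_tors` (type `III`/`III*`: `c_p = 2`, `E₀/E₁ ≅ 𝔽_p⁺`, so `[m]G ∈ E₁(ℚ_p)`, the formal
group) and `log_ω` the formal logarithm of the minimal model, `n := v_p(log_ω([m]G)/m)` — the
convention of bsd-cm-ram's `c7_levels.gp` (kit j236953). Since `p ≥ 5` the logarithm is an isometry on
`E₁(ℚ_p)`, so `n + 1 = v_p(t([m]G)) = −v_p(x([m]G))/2` (`t = −x/y`); the record stores the two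
engines' valuations and the kernel checks this relation. A record holds, per cell: `E` (curve 1) with
its generator `(gX/gd², gY/gd³)` and `#tors`, the twin `E'` (class member `twinNum`, the quadratic twist
by `−p`: `c₄(E')·w₁⁴ = p²·c₄(E)·w₂⁴`, `c₆(E')·w₁⁶ = −p³·c₆(E)·w₂⁶`) with its generator and `#tors`, the
multipliers `m, m'`, the levels `n, n'`, ENGINE A's `v_p(x([m]G))`, ENGINE B's `v_p(t([m]G))` (same for
`E'`), the two `#Ш_an` (from the PART-A rows, two engines there) and `pred = n + n' + ord_p(#Ш_an·#Ш'_an)`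
= the right-hand side of (★_an). ENGINES: A = PARI/GP `ellpadiclog(E, p, 30, [m]G)/m` on the exact
multiple (kit job named in the display file); B = an independent implementation (python, exact rational
group law, formal-group parameter `t`, formal logarithm series from `a₁…a₆` by the `w(t)` recursion of
*AEC* IV.1, evaluated `p`-adically; kit job named in the display file). `LevelRow.consistent` rechecks:
generators ON their curves (exact), the twist identities, `m = 2p·#tors`, `m' = 2p·#tors'`,
`vxA = −2(n+1)`, `vtB = n+1` (and primed), `pred = n + n' + v_p(#Ш_an) + v_p(#Ш'_an)`, engine count `2`.
NOT rechecked: the multiples `[m]G` and the logarithms themselves (engines' work).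

## §2 `ThreeMetaRow` — print-family META of a cell of the slice `p = 3` (planner PLAN.md §2 «ty3»)

For a K12r@3 class (CM by `ℚ(√−3)`; every `j = 0` member is `≅ y² = x³ + k`, `k` sixth-power-free —
PART A's `twistD`), the record lists the `j = 0` members with `(k, u₁, u₂, Manin c)` (`c₄ = 0`,
`c₆·u₁⁶ = −864·k·u₂⁶`; `c` = Cremona's `opt_man` Manin constant of that member) and decides, on these
integers, membership in the two PRINTED rank-one `BSD(E,3)` families of the tree:
* Kriz–Li 2019 Thm. 1.23 (= Thm. 10.10; tree consumer `X12.SexticTwistFamily.bsdp_three_sexticTwist_family`,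
  hypotheses as typed there): a member `≅ E_d : y² = x³ − 432·d` (`k·a⁶ = −432·d·b⁶`, fields
  `sexticNum/sexticD/sexticA/sexticB`) with (1) `d` a FUNDAMENTAL discriminant (`h1`, on the recorded
  factorisation of `|d|`), (2) `d mod 9 ∈ {2,3,5,8}` (`h9`; field `dMod9`) together with the RANK-ONE sign
  `(d < 0 ∧ d ≡ 2) ∨ (d > 0 ∧ d ≡ 3,5,8 (mod 9))` (Cor. 10.7 (2); field `klSign`), (3a) `3 ∤ h(ℚ(√−3d))`
  (`d > 0`) resp. `3 ∤ h(ℚ(√d))` (`d < 0`) (`h3a`; fields `klField` = that field's discriminant, recomputed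
  from the factorisation, `klClassNo` with `classNoEngines` = PARI `qfbclassno`/`quadclassunit` ‖ a
  reduced-forms count, `kl3a`), (4) `3 ∤ c` for that member (`h4`; field `kl4`);
* the cube-sum families (Hu–Shu–Yin 2019 Thm. 1.4 `C_p`, Kezuka–Li 2020 Cor. 1.2 `C_{2p}, C_{2p²}`,
  Shu–Yin 2022 Thm. 1.2 `C_{3p}, C_{3p²}`; tree consumers in `X12/CubeSumFamilies.lean`): a member
  `≅ C_n : x³ + y³ = n`, i.e. `≅ y² = x³ − 432·n²` (`k·a⁶ = −432·n²·b⁶`, `n` cube-free; fields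
  `cubeNum/cubeN/cubeA/cubeB/cubeNfactors`) — the family's own congruence conditions on `n` are NOT
  re-decided here (they are hypotheses of the booking theorem, decided there);
and carries the BOOKING STATUS of the class in the tree: `status = 1` with `bookedBy` = the fully
qualified tree theorem that books the class BY NAME from a printed family (13 window classes: sextic
`225a, 1323m, 1728a, 3888t, 7803b, 11907s, 15129a`; cube-sum `441b, 4563b, 16641a` (HSY), `2700h,
13068c` (KL20), `6075bc` (SY22)), `status = 0` otherwise (per-pair lane certificates only — never a
leaf closure, REFEREE R0.5). `ThreeMetaRow.consistent` rechecks every identity above, the fundamental /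
cube-free tests on recorded factorisations, `dMod9`, `klSign`, `klField`, `kl3a`, `kl4`, and
`status = 1 → (sextic member with (1) ∧ (2)+sign ∧ (3a) ∧ (4)) ∨ cube-sum member` (`bookedBy` itself is a
display string).

References: `X12/CMRamifiedRecordSchema.lean` (PART A; helpers reused from the X10b records);
`X12/O11/RamifiedStrictDescent.lean` ((★_an), `ν = n + n'`); bsd-cm-ram `c7_levels.gp` (kit j236953);
[KrizLi2019] Thm. 1.23 / Cor. 10.7; [HuShuYin2019] Thm. 1.4; [KezukaLi2020] Cor. 1.2; [ShuYin2022]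
Thm. 1.2; [SilvermanAEC2009] IV.1 (formal group), VII.2.2 (filtration); [Cremona1997] `ecdata opt_man`.
-/

set_option autoImplicit false

namespace Summit.BirchSwinnertonDyer.Rank1Residual.X12.CMRamifiedRecords

open Summit.BirchSwinnertonDyer.BirchSwinnertonDyer.Rank1Residual.HeegnerIndexRecords
open Summit.BirchSwinnertonDyer.Rank1Residual.X10.JetchevTamagawaRecords (c6)

/-! ### §1 Levels (slice `p ≥ 5`) -/

/-- One `p`-LEVEL record of a census cell `(class, p)`, `p ≥ 5` (module docstring §1): curve 1 `E`
with generator and `#tors`, the `p`-isogenous twin `E' = E^{(−p)}` (member `twinNum`) with generator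
and `#tors`, the twist scalings `w1/w2`, multipliers `m, m'`, levels `n, n'`, ENGINE A's
`v_p(x([m]G))`, ENGINE B's `v_p(t([m]G))` (primed for `E'`), the two `#Ш_an`, and
`pred = n + n' + ord_p(#Ш_an·#Ш'_an)`. [folklore] -/
structure LevelRow where
  label : String
  p : ℕ
  ainvs : List ℤ
  tors : ℕ
  gX : ℤ
  gY : ℤ
  gd : ℕ
  m : ℕ
  n : ℕ
  vxA : ℤ
  vtB : ℕ
  twinNum : ℕ
  twinAinvs : List ℤ
  w1 : ℕ
  w2 : ℕ
  twinTors : ℕ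
  tgX : ℤ
  tgY : ℤ
  tgd : ℕ
  m' : ℕ
  n' : ℕ
  vxA' : ℤ
  vtB' : ℕ
  shaAn : ℕ
  twinShaAn : ℕ
  pred : ℕ
  levelEngines : ℕ
  engines : String

/-- The in-kernel recheck of a `LevelRow` (module docstring §1). [folklore] -/
def LevelRow.consistent (r : LevelRow) : Bool :=
  (r.ainvs.length == 5) && (r.twinAinvs.length == 5) && decide (5 ≤ r.p) &&
  -- generators on their curves, exactly
  decide (1 ≤ r.gd) && (weierstrassEvalZ r.ainvs r.gX r.gY r.gd == 0) &&
  decide (1 ≤ r.tgd) && (weierstrassEvalZ r.twinAinvs r.tgX r.tgY r.tgd == 0) &&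
  -- `E'` is the quadratic twist of `E` by `−p`
  decide (1 ≤ r.w1) && decide (1 ≤ r.w2) &&
  (c4 r.twinAinvs * (r.w1 : ℤ) ^ 4 == (r.p : ℤ) ^ 2 * c4 r.ainvs * (r.w2 : ℤ) ^ 4) &&
  (c6 r.twinAinvs * (r.w1 : ℤ) ^ 6 == -((r.p : ℤ) ^ 3) * c6 r.ainvs * (r.w2 : ℤ) ^ 6) &&
  -- multipliers and the level/valuation relations of both engines
  decide (1 ≤ r.tors) && decide (1 ≤ r.twinTors) &&
  (r.m == 2 * r.p * r.tors) && (r.m' == 2 * r.p * r.twinTors) &&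
  (r.vxA == -(2 * ((r.n : ℤ) + 1))) && (r.vtB == r.n + 1) &&
  (r.vxA' == -(2 * ((r.n' : ℤ) + 1))) && (r.vtB' == r.n' + 1) &&
  -- the right-hand side of (★_an)
  decide (1 ≤ r.shaAn) && decide (1 ≤ r.twinShaAn) &&
  (r.pred == r.n + r.n' + vp r.p r.shaAn + vp r.p r.twinShaAn) && decide (2 ≤ r.levelEngines)

/-- A consistent level record reads `pred = n + n' + ord_p #Ш_an + ord_p #Ш'_an`. [folklore] -/
theorem LevelRow.pred_eq_of_consistent {r : LevelRow} (h : r.consistent = true) :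
    r.pred = r.n + r.n' + vp r.p r.shaAn + vp r.p r.twinShaAn := by
  simp only [LevelRow.consistent, Bool.and_eq_true, beq_iff_eq, decide_eq_true_eq] at h
  obtain ⟨⟨-, hp⟩, -⟩ := h
  exact hp

/-- Unpacking a display theorem `rs.all LevelRow.consistent = true` per member. [folklore] -/
theorem LevelRow.consistent_of_all {rs : List LevelRow} (h : rs.all LevelRow.consistent = true)
    {r : LevelRow} (hr : r ∈ rs) : r.consistent = true :=
  List.all_eq_true.1 h r hr

/-! ### §2 Print-family meta (slice `p = 3`) -/

/-- A `j = 0` member of a K12r@3 class: Cremona number, minimal a-invariants, the sixth-power-free `k`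
with `E ≅ y² = x³ + k` (`c₄ = 0`, `c₆·u₁⁶ = −864·k·u₂⁶`), and Cremona's Manin constant. [folklore] -/
structure J0Member where
  num : ℕ
  ainvs : List ℤ
  k : ℤ
  u1 : ℕ
  u2 : ℕ
  manin : ℕ

/-- The `k`-identity of a `J0Member`. [folklore] -/
def J0Member.ok (m : J0Member) : Bool :=
  (m.ainvs.length == 5) && (c4 m.ainvs == 0) && decide (1 ≤ m.u1) && decide (1 ≤ m.u2) && (m.k != 0) &&
    (c6 m.ainvs * (m.u1 : ℤ) ^ 6 == -864 * m.k * (m.u2 : ℤ) ^ 6) && decide (1 ≤ m.manin)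

/-- `d` is a fundamental discriminant, decided on a recorded prime factorisation `fs` of `|d|` — the
shape of hypothesis `h1` of `X12.SexticTwistFamily.bsdp_three_sexticTwist_family`:
`(d ≡ 1 (mod 4) ∧ d square-free ∧ d ≠ 1) ∨ (4 ∣ d ∧ d/4 ≡ 2, 3 (mod 4) ∧ d/4 square-free)`. [folklore] -/
def isFundamentalByFactors (d : ℤ) (fs : List (ℕ × ℕ)) : Bool :=
  (d != 0) && (d != 1) && factorsOK d.natAbs fs &&
  ((d % 4 == 1 && fs.all (fun qe => qe.2 == 1)) ||
   (d % 4 == 0 && (d / 4 % 4 == 2 || d / 4 % 4 == 3) &&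
     fs.all (fun qe => (qe.1 == 2 && (qe.2 == 2 || qe.2 == 3)) || (qe.1 != 2 && qe.2 == 1))))

/-- The discriminant of the quadratic field `ℚ(√D)` for `D = s · ∏ q^e` given by a sign and a
factorisation: square-free kernel `m = s · ∏ q^{e mod 2}`, then `m` if `m ≡ 1 (mod 4)` else `4m`. [folklore] -/
def fieldDiscOfFactors (negative : Bool) (fs : List (ℕ × ℕ)) : ℤ :=
  let m : ℤ := (if negative then -1 else 1) *
    fs.foldl (fun (acc : ℤ) qe => if qe.2 % 2 == 1 then acc * (qe.1 : ℤ) else acc) 1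
  if m % 4 == 1 then m else 4 * m

/-- Merge the prime `3` into a factorisation (exponent `+1`), for the field `ℚ(√−3d)`. [folklore] -/
def mulThreeFactors (fs : List (ℕ × ℕ)) : List (ℕ × ℕ) :=
  if fs.any (fun qe => qe.1 == 3) then fs.map (fun qe => if qe.1 == 3 then (3, qe.2 + 1) else qe)
  else (3, 1) :: fs

/-- `n ≠ 0` is cube-free, on a recorded factorisation of `|n|`. [folklore] -/
def cubeFreeByFactors (n : ℕ) (fs : List (ℕ × ℕ)) : Bool :=
  decide (1 ≤ n) && factorsOK n fs && fs.all (fun qe => decide (qe.2 ≤ 2))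

/-- **Print-family META record of a K12r@3 class** (module docstring §2). `sexticNum = 0` / `cubeNum = 0`
mean "no member of that shape"; `status`: `1` = booked BY NAME by the tree theorem `bookedBy` (a printed
family), `0` = no class-level print record. [folklore] -/
structure ThreeMetaRow where
  label : String
  cls : String
  j0 : List J0Member
  sexticNum : ℕ
  sexticD : ℤ
  sexticA : ℕ
  sexticB : ℕ
  sexticDfactors : List (ℕ × ℕ)
  dMod9 : ℕ
  klSign : Bool
  klField : ℤ
  klClassNo : ℕ
  classNoEngines : ℕ
  kl3a : Bool
  kl4 : Bool
  cubeNum : ℕ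
  cubeN : ℕ
  cubeA : ℕ
  cubeB : ℕ
  cubeNfactors : List (ℕ × ℕ)
  bookedBy : String
  status : ℕ
  engines : String

namespace ThreeMetaRow

/-- The member numbered `i` among the `j = 0` members (junk: the empty member). [folklore] -/
def memberK (r : ThreeMetaRow) (i : ℕ) : ℤ :=
  match r.j0.find? (fun m => m.num == i) with
  | some m => m.k
  | none => 0

/-- The Manin constant of the member numbered `i` (junk `0`). [folklore] -/
def memberManin (r : ThreeMetaRow) (i : ℕ) : ℕ :=
  match r.j0.find? (fun m => m.num == i) with
  | some m => m.manin
  | none => 0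

/-- The Kriz–Li block: either no sextic member (`sexticNum = 0`, all KL flags `false`, `sexticD = 0`),
or member `sexticNum ≅ E_d` (`k·a⁶ = −432·d·b⁶`) with `d` fundamental, and the flags RECOMPUTED:
`dMod9 = d mod 9`, `klSign ↔ (d<0 ∧ d≡2) ∨ (d>0 ∧ d≡3,5,8 (mod 9))`, `klField` = disc of `ℚ(√−3d)`
(`d > 0`) / `ℚ(√d)` (`d < 0`), `kl3a ↔ 3 ∤ klClassNo`, `kl4 ↔ 3 ∤ c(member)`. [folklore] -/
def sexticOK (r : ThreeMetaRow) : Bool :=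
  (r.sexticNum == 0 && r.sexticD == 0 && !r.klSign && !r.kl3a && !r.kl4) ||
  ((r.j0.any fun m => m.num == r.sexticNum) && decide (1 ≤ r.sexticA) && decide (1 ≤ r.sexticB) &&
    (r.memberK r.sexticNum * (r.sexticA : ℤ) ^ 6 == -432 * r.sexticD * (r.sexticB : ℤ) ^ 6) &&
    isFundamentalByFactors r.sexticD r.sexticDfactors &&
    ((r.dMod9 : ℤ) == r.sexticD % 9) &&
    (r.klSign == ((decide (r.sexticD < 0) && r.dMod9 == 2) ||
      (decide (0 < r.sexticD) && (r.dMod9 == 3 || r.dMod9 == 5 || r.dMod9 == 8)))) &&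
    (r.klField == (if decide (0 < r.sexticD) then fieldDiscOfFactors true (mulThreeFactors r.sexticDfactors)
                   else fieldDiscOfFactors true r.sexticDfactors)) &&
    decide (1 ≤ r.klClassNo) && decide (2 ≤ r.classNoEngines) &&
    (r.kl3a == (r.klClassNo % 3 != 0)) && (r.kl4 == (r.memberManin r.sexticNum % 3 != 0)))

/-- The cube-sum block: no cube-sum member, or member `cubeNum ≅ C_n` (`k·a⁶ = −432·n²·b⁶`, `n`
cube-free). [folklore] -/
def cubeOK (r : ThreeMetaRow) : Bool :=
  (r.cubeNum == 0 && r.cubeN == 0) ||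
  ((r.j0.any fun m => m.num == r.cubeNum) && decide (1 ≤ r.cubeA) && decide (1 ≤ r.cubeB) &&
    (r.memberK r.cubeNum * (r.cubeA : ℤ) ^ 6 == -432 * (r.cubeN : ℤ) ^ 2 * (r.cubeB : ℤ) ^ 6) &&
    cubeFreeByFactors r.cubeN r.cubeNfactors)

/-- The booking-status block: `status ∈ {0, 1}`, and a booked class (`status = 1`) has a sextic member
passing (1), (2)+sign, (3a), (4) or a cube-sum member. (`bookedBy` is a display string — the FQN of the
booking theorem —, not compared in the kernel; the display generator enforces `status = 1 ↔ bookedBy ≠ ""`.)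
[folklore] -/
def statusOK (r : ThreeMetaRow) : Bool :=
  (r.status == 0) ||
  (r.status == 1 && ((r.sexticNum != 0 && r.klSign && r.kl3a && r.kl4) || r.cubeNum != 0))

/-- **The in-kernel recheck of a `ThreeMetaRow`**: members' `k`-identities, the Kriz–Li block, the
cube-sum block, the status block. [folklore] -/
def consistent (r : ThreeMetaRow) : Bool :=
  decide (1 ≤ r.j0.length) && r.j0.all J0Member.ok && r.sexticOK && r.cubeOK && r.statusOK

/-- `consistent` unpacked. [folklore] -/
theorem consistent_iff (r : ThreeMetaRow) :
    r.consistent = true ↔ 1 ≤ r.j0.length ∧ r.j0.all J0Member.ok = true ∧ r.sexticOK = true ∧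
      r.cubeOK = true ∧ r.statusOK = true := by
  simp only [consistent, Bool.and_eq_true, decide_eq_true_eq]
  tauto

/-- Unpacking a display theorem `rs.all ThreeMetaRow.consistent = true` per member. [folklore] -/
theorem consistent_of_all {rs : List ThreeMetaRow} (h : rs.all ThreeMetaRow.consistent = true)
    {r : ThreeMetaRow} (hr : r ∈ rs) : r.consistent = true :=
  List.all_eq_true.1 h r hr

end ThreeMetaRow

end Summit.BirchSwinnertonDyer.Rank1Residual.X12.CMRamifiedRecords
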